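import Summits.QuantumFields.YangMills.Theorems.AllWindowsColdBoxBulkMidFluxExtensionInterp

/-!
# LINE-18 (crux `AllWindowsColdBox.BulkMidWindowSU2`, ⟨stmt-QuantumFields-24006⟩), toward the gauge-invariant flux maximum
# principle K3″: comb potentials (line integrals along coordinate combs) and their strip identities

For an edge function `ϑ` on `ℤ⁴`, `lineInt ϑ c y = Σ_{−1 ≤ t < y_c} ϑ (y|_{y_c = t}, c)` is the line integral of `ϑ` along
coordinate `c` from the floor `{y_c = −1}` up to `y`, and `comb ϑ y` is the comb potential obtained by integrating first along
coordinate `1` (on the axis `{y₂ = y₃ = −1}`), then along `2` (on the floor `{y₃ = −1}`), then along `3`; coordinate `0` is never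
moved, so on a cap `{y₀ = const}` of the enlarged box the comb stays inside the cap.  The STRIP IDENTITIES express the defect
`ϑ(e) − (κ(e⁺) − κ(e⁻))` of such a potential on an edge `e` as (minus) a sum of circulations `sCirc ϑ` over the thin strip of
plaquettes swept by the comb:

* `lineInt_add_single_self`, `lineInt_add_single_of_ne` — one level: exact along `c`, strip of `(i,c)`-plaquettes across;
* `comb_defect_three`, `comb_defect_two`, `comb_defect_one` — the comb potential is exact on `3`-edges, and its defect on
  `2`-edges (resp. `1`-edges) is minus the sum of `≤ 2H+2` (resp. `≤ 4H+4`) plaquette circulations;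
* `abs_comb_defect_le` — hence `|ϑ(e) − dκ(e)| ≤ (4H+4)·ε` whenever those circulations are `≤ ε` in absolute value.

Finite sums only.  HONEST LABEL: helper toward an UNREGISTERED internal obligation (K3″) of a critic-passed DRAFT line on the
R2ξ″ RECORD-rung crux 24006; no stub, crux, rung or summit is proved here; the Yang–Mills mass gap is NOT proved by this file.
-/

set_option autoImplicit false

noncomputable section

open Finset Function
open Literature.Probability.LatticeModels (Site)
open Literature.MathematicalPhysics.QuantumFieldTheory
open Literature.MathematicalPhysics.QuantumFieldTheory.LatticeMaxwell

namespace Summit.QuantumFields.YangMills.Theorems.AllWindowsColdBoxBulkMidLine.FluxExt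

variable (ϑ : Literature.MathematicalPhysics.QuantumLattice.ZdEdge 4 → ℝ)

/-! ## One level: the line integral along a coordinate -/

/-- The line integral of `ϑ` along coordinate `c` from the floor `{y_c = −1}` up to `y`:
`Σ_{m < y_c + 1} ϑ (y|_{y_c = −1 + m}, c)`. -/
def lineInt (c : Fin 4) (y : Site 4) : ℝ :=
  ∑ m ∈ range (y c + 1).toNat, ϑ (update y c (-1 + (m : ℤ)), c)

/-- Consecutive points of the line: `y|_{y_c = −1+m} + e_c = y|_{y_c = −1+(m+1)}`. -/
theorem update_add_single_succ (c : Fin 4) (y : Site 4) (m : ℕ) :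
    update y c (-1 + (m : ℤ)) + Pi.single c (1 : ℤ) = update y c (-1 + ((m + 1 : ℕ) : ℤ)) := by
  ext k
  by_cases hk : k = c
  · subst hk; simp
  · simp [hk]

/-- **The line integral is exact along its own coordinate**: `lineInt c (y + e_c) = lineInt c y + ϑ (y, c)` (`y_c ≥ −1`). -/
theorem lineInt_add_single_self (c : Fin 4) {y : Site 4} (hy : -1 ≤ y c) :
    lineInt ϑ c (y + Pi.single c 1) = lineInt ϑ c y + ϑ (y, c) := by
  have hn : ((y + Pi.single c (1 : ℤ) : Site 4) c + 1).toNat = (y c + 1).toNat + 1 := by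
    simp only [Pi.add_apply, Pi.single_eq_same]; omega
  simp only [lineInt, hn, Finset.sum_range_succ, update_add_single_self]
  congr 1
  have : (-1 : ℤ) + ((y c + 1).toNat : ℕ) = y c := by omega
  rw [this, update_eq_self]

/-- **The strip identity for one level**: for `i ≠ c` and `y_c ≥ −1`,
`lineInt c (y + e_i) − lineInt c y = Σ_{m} sCirc ϑ (y|_{y_c=−1+m}, i, c) − ϑ (y|_{y_c=−1}, i) + ϑ (y, i)`. -/
theorem lineInt_add_single_of_ne {i c : Fin 4} (hic : i ≠ c) {y : Site 4} (hy : -1 ≤ y c) :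
    lineInt ϑ c (y + Pi.single i 1) - lineInt ϑ c y =
      (∑ m ∈ range (y c + 1).toNat, sCirc ϑ (update y c (-1 + (m : ℤ)), i, c)) -
        ϑ (update y c (-1), i) + ϑ (y, i) := by
  have hn : ((y + Pi.single i (1 : ℤ) : Site 4) c + 1).toNat = (y c + 1).toNat := by
    simp [hic.symm]
  simp only [lineInt, hn, update_add_single_of_ne hic, ← Finset.sum_sub_distrib]
  -- telescoping of the `i`-values along the line
  have htel : ∑ m ∈ range (y c + 1).toNat,
      (ϑ (update y c (-1 + (m : ℤ)), i) - ϑ (update y c (-1 + ((m + 1 : ℕ) : ℤ)), i)) =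
      ϑ (update y c (-1), i) - ϑ (y, i) := by
    rw [Finset.sum_range_sub' (fun m : ℕ => ϑ (update y c (-1 + (m : ℤ)), i))]
    have : (-1 : ℤ) + ((y c + 1).toNat : ℕ) = y c := by omega
    simp only [Nat.cast_zero, add_zero, this, update_eq_self]
  have hs : ∀ m : ℕ, sCirc ϑ (update y c (-1 + (m : ℤ)), i, c) =
      (ϑ (update y c (-1 + (m : ℤ)) + Pi.single i 1, c) - ϑ (update y c (-1 + (m : ℤ)), c)) +
        (ϑ (update y c (-1 + (m : ℤ)), i) - ϑ (update y c (-1 + ((m + 1 : ℕ) : ℤ)), i)) := by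
    intro m
    simp only [sCirc, update_add_single_succ]
    ring
  simp only [hs, Finset.sum_add_distrib, htel]
  ring

/-! ## The comb potential on a cap -/

/-- **The comb potential**: integrate `ϑ` along coordinate `1` on the axis `{y₂ = y₃ = −1}`, then along `2` on the floor
`{y₃ = −1}`, then along `3`; coordinate `0` (the cap label) is never changed. -/
def comb (y : Site 4) : ℝ :=
  lineInt ϑ 1 (update (update y 2 (-1)) 3 (-1)) + lineInt ϑ 2 (update y 3 (-1)) + lineInt ϑ 3 y

/-- The comb potential is exact on `3`-edges: `ϑ (y, 3) = comb (y + e₃) − comb y` (`y₃ ≥ −1`). -/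
theorem comb_defect_three {y : Site 4} (hy3 : -1 ≤ y 3) :
    ϑ (y, 3) - (comb ϑ (y + Pi.single 3 1) - comb ϑ y) = 0 := by
  have h2 : update (update (y + Pi.single (3 : Fin 4) (1 : ℤ)) 2 (-1 : ℤ)) 3 (-1 : ℤ) = update (update y 2 (-1)) 3 (-1) := by
    rw [update_add_single_of_ne (show (3 : Fin 4) ≠ 2 by decide), update_add_single_self]
  simp only [comb, h2, update_add_single_self, lineInt_add_single_self ϑ 3 hy3]
  ring

/-- **Strip identity on `2`-edges**: `ϑ (y, 2) − (comb (y + e₂) − comb y) = − Σ_{m < y₃+1} sCirc ϑ (y|_{y₃ = −1+m}, 2, 3)`. -/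
theorem comb_defect_two {y : Site 4} (hy2 : -1 ≤ y 2) (hy3 : -1 ≤ y 3) :
    ϑ (y, 2) - (comb ϑ (y + Pi.single 2 1) - comb ϑ y) =
      -∑ m ∈ range (y 3 + 1).toNat, sCirc ϑ (update y 3 (-1 + (m : ℤ)), 2, 3) := by
  have h1 : update (update (y + Pi.single (2 : Fin 4) (1 : ℤ)) 2 (-1 : ℤ)) 3 (-1 : ℤ) = update (update y 2 (-1)) 3 (-1) := by
    rw [update_add_single_self]
  have h2 : update (y + Pi.single (2 : Fin 4) (1 : ℤ)) 3 (-1 : ℤ) = update y 3 (-1) + Pi.single 2 1 :=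
    update_add_single_of_ne (by decide) y (-1)
  have hw2 : -1 ≤ (update y 3 (-1 : ℤ) : Site 4) 2 := by simpa using hy2
  have hl2 := lineInt_add_single_self ϑ 2 hw2
  have hl3 := lineInt_add_single_of_ne ϑ (show (2 : Fin 4) ≠ 3 by decide) hy3
  simp only [comb, h1, h2, hl2]
  have e1 : (update y 3 (-1 : ℤ), (2 : Fin 4)) = (update y (3 : Fin 4) (-1 : ℤ), (2 : Fin 4)) := rfl
  linarith

/-- **Strip identity on `1`-edges**:
`ϑ (y, 1) − (comb (y + e₁) − comb y) = − Σ_{m < y₂+1} sCirc ϑ (y|_{y₃=−1, y₂=−1+m}, 1, 2) − Σ_{m < y₃+1} sCirc ϑ (y|_{y₃=−1+m}, 1, 3)`. -/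
theorem comb_defect_one {y : Site 4} (hy1 : -1 ≤ y 1) (hy2 : -1 ≤ y 2) (hy3 : -1 ≤ y 3) :
    ϑ (y, 1) - (comb ϑ (y + Pi.single 1 1) - comb ϑ y) =
      -(∑ m ∈ range (y 2 + 1).toNat, sCirc ϑ (update (update y 3 (-1)) 2 (-1 + (m : ℤ)), 1, 2)) -
        ∑ m ∈ range (y 3 + 1).toNat, sCirc ϑ (update y 3 (-1 + (m : ℤ)), 1, 3) := by
  have h1 : update (update (y + Pi.single (1 : Fin 4) (1 : ℤ)) 2 (-1 : ℤ)) 3 (-1 : ℤ) =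
      update (update y 2 (-1)) 3 (-1) + Pi.single 1 1 := by
    rw [update_add_single_of_ne (show (1 : Fin 4) ≠ 2 by decide), update_add_single_of_ne (show (1 : Fin 4) ≠ 3 by decide)]
  have h2 : update (y + Pi.single (1 : Fin 4) (1 : ℤ)) 3 (-1 : ℤ) = update y 3 (-1) + Pi.single 1 1 :=
    update_add_single_of_ne (by decide) y (-1)
  have hu : update (update y 2 (-1 : ℤ)) 3 (-1 : ℤ) = update (update y 3 (-1 : ℤ)) 2 (-1 : ℤ) :=
    update_comm (by decide) _ _ _
  have hw1 : -1 ≤ (update (update y 2 (-1 : ℤ)) 3 (-1 : ℤ) : Site 4) 1 := by simpa using hy1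
  have hw2 : -1 ≤ (update y 3 (-1 : ℤ) : Site 4) 2 := by simpa using hy2
  have hl1 := lineInt_add_single_self ϑ 1 hw1
  have hl2 := lineInt_add_single_of_ne ϑ (show (1 : Fin 4) ≠ 2 by decide) hw2
  have hl3 := lineInt_add_single_of_ne ϑ (show (1 : Fin 4) ≠ 3 by decide) hy3
  have hn2 : ((update y 3 (-1 : ℤ) : Site 4) 2 + 1).toNat = (y 2 + 1).toNat := by simp
  rw [hn2] at hl2
  simp only [comb, h1, h2, hl1]
  rw [hu]
  linarith

/-! ## Bounds -/

/-- A sum of `n` terms bounded by `ε` in absolute value is bounded by `n·ε`. -/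
theorem abs_sum_range_le {n : ℕ} {f : ℕ → ℝ} {ε : ℝ} (h : ∀ m, m < n → |f m| ≤ ε) :
    |∑ m ∈ range n, f m| ≤ n * ε := by
  calc |∑ m ∈ range n, f m| ≤ ∑ m ∈ range n, |f m| := Finset.abs_sum_le_sum_abs _ _
    _ ≤ ∑ _m ∈ range n, ε := Finset.sum_le_sum fun m hm => h m (Finset.mem_range.1 hm)
    _ = n * ε := by rw [Finset.sum_const, Finset.card_range, nsmul_eq_mul]

/-- **Defect bound for the comb potential.**  Let `y` lie in the enlarged box (`−1 ≤ y_k ≤ 2H+1` for `k = 1,2,3`) and let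
every plaquette `(z, a, b)` with `a < b` in `{1,2,3}` whose base point `z` agrees with `y` in coordinate `0` and lies in the
enlarged box have `|sCirc ϑ (z,a,b)| ≤ ε`.  Then for each `i ∈ {1,2,3}`, `|ϑ (y, i) − (comb (y + e_i) − comb y)| ≤ (4H+4)·ε`. -/
theorem abs_comb_defect_le (H : ℕ) {ε : ℝ} (hε : 0 ≤ ε) {y : Site 4}
    (hy : ∀ k : Fin 4, k ≠ 0 → -1 ≤ y k ∧ y k ≤ 2 * (H : ℤ) + 1)
    (hflux : ∀ (z : Site 4) (a b : Fin 4), a ≠ 0 → a < b → z 0 = y 0 →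
      (∀ k : Fin 4, k ≠ 0 → -1 ≤ z k ∧ z k ≤ 2 * (H : ℤ) + 1) → |sCirc ϑ (z, a, b)| ≤ ε)
    {i : Fin 4} (hi : i ≠ 0) :
    |ϑ (y, i) - (comb ϑ (y + Pi.single i 1) - comb ϑ y)| ≤ (4 * H + 4) * ε := by
  have hy1 := hy 1 (by decide); have hy2 := hy 2 (by decide); have hy3 := hy 3 (by decide)
  have hn2 : ((y 2 + 1).toNat : ℝ) ≤ 2 * H + 2 := by
    have : (y 2 + 1).toNat ≤ 2 * H + 2 := by omega
    exact_mod_cast this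
  have hn3 : ((y 3 + 1).toNat : ℝ) ≤ 2 * H + 2 := by
    have : (y 3 + 1).toNat ≤ 2 * H + 2 := by omega
    exact_mod_cast this
  -- range facts for the strip base points
  have hz3 : ∀ m : ℕ, m < (y 3 + 1).toNat →
      (update y 3 (-1 + (m : ℤ)) : Site 4) 0 = y 0 ∧
        ∀ k : Fin 4, k ≠ 0 → -1 ≤ (update y 3 (-1 + (m : ℤ)) : Site 4) k ∧
          (update y 3 (-1 + (m : ℤ)) : Site 4) k ≤ 2 * (H : ℤ) + 1 := by
    intro m hm
    refine ⟨by simp, fun k hk => ?_⟩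
    by_cases hk3 : k = 3
    · subst hk3; simp; omega
    · simp [hk3]; exact hy k hk
  have hz2 : ∀ m : ℕ, m < (y 2 + 1).toNat →
      (update (update y 3 (-1)) 2 (-1 + (m : ℤ)) : Site 4) 0 = y 0 ∧
        ∀ k : Fin 4, k ≠ 0 → -1 ≤ (update (update y 3 (-1)) 2 (-1 + (m : ℤ)) : Site 4) k ∧
          (update (update y 3 (-1)) 2 (-1 + (m : ℤ)) : Site 4) k ≤ 2 * (H : ℤ) + 1 := by
    intro m hm
    refine ⟨by simp, fun k hk => ?_⟩
    by_cases hk2 : k = 2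
    · subst hk2; simp; omega
    · by_cases hk3 : k = 3
      · subst hk3; simp; omega
      · simp [hk2, hk3]; exact hy k hk
  have hS3 : ∀ a : Fin 4, a ≠ 0 → a < 3 →
      |∑ m ∈ range (y 3 + 1).toNat, sCirc ϑ (update y 3 (-1 + (m : ℤ)), a, 3)| ≤ (2 * H + 2) * ε := by
    intro a ha0 ha3
    refine (abs_sum_range_le fun m hm => ?_).trans (mul_le_mul_of_nonneg_right hn3 hε)
    obtain ⟨h0, hk⟩ := hz3 m hm
    exact hflux _ a 3 ha0 ha3 h0 hk
  have hS2 : |∑ m ∈ range (y 2 + 1).toNat, sCirc ϑ (update (update y 3 (-1)) 2 (-1 + (m : ℤ)), 1, 2)| ≤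
      (2 * H + 2) * ε := by
    refine (abs_sum_range_le fun m hm => ?_).trans (mul_le_mul_of_nonneg_right hn2 hε)
    obtain ⟨h0, hk⟩ := hz2 m hm
    exact hflux _ 1 2 (by decide) (by decide) h0 hk
  have hH : (0 : ℝ) ≤ (2 * H + 2) * ε := by positivity
  fin_cases i
  · exact absurd rfl hi
  · rw [show ((⟨1, by norm_num⟩ : Fin 4)) = 1 from rfl, comb_defect_one ϑ hy1.1 hy2.1 hy3.1]
    calc _ ≤ |-(∑ m ∈ range (y 2 + 1).toNat, sCirc ϑ (update (update y 3 (-1)) 2 (-1 + (m : ℤ)), 1, 2))| +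
          |∑ m ∈ range (y 3 + 1).toNat, sCirc ϑ (update y 3 (-1 + (m : ℤ)), 1, 3)| := abs_sub _ _
      _ ≤ (2 * H + 2) * ε + (2 * H + 2) * ε := by
          rw [abs_neg]; exact add_le_add hS2 (hS3 1 (by decide) (by decide))
      _ = (4 * H + 4) * ε := by ring
  · rw [show ((⟨2, by norm_num⟩ : Fin 4)) = 2 from rfl, comb_defect_two ϑ hy2.1 hy3.1, abs_neg]
    exact (hS3 2 (by decide) (by decide)).trans (by nlinarith)
  · rw [show ((⟨3, by norm_num⟩ : Fin 4)) = 3 from rfl, comb_defect_three ϑ hy3.1, abs_zero]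
    positivity

end Summit.QuantumFields.YangMills.Theorems.AllWindowsColdBoxBulkMidLine.FluxExt

end
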